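import Summits.CriticalPhenomena.Ising3DConformalLimit.Theorems.HyperoctahedralRPExistsScaleCovariantLimitFoldedCurrentDefs
import HarnessLib

/-!
# Line `folded-current-repulsion` (crux `ExistsScaleCovariantLimit`, stmt-CriticalPhenomena-1981): fold data for every coordinate mirror

Lead `prover-line-stmt-CriticalPhenomena-1981-c11-0`. The definitions module `…FoldedCurrentDefs.lean` (p137559) fixes the mirror
`x₀ ↦ −x₀`. The card's TRANSVERSE cut (4) — `G(ke₀ + 2je₁)/g(k) = P^{0,ke₀}[ke₀ ⟷ {x₁ = j} folded]` — needs the same objects for the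
mirror in another coordinate. This file carries them for an arbitrary coordinate `i : Fin 3` (definitions with parameters, route-posited
objects, nothing asserted): `mirrorAt i` (`xᵢ ↦ −xᵢ`), `leftHalfAt i L = Λ_L ∩ {xᵢ < 0}`, the fold datum `isFoldable_boxAt i L`
(Duminil-Copin–Panis 2025 §2.2 = Aizenman 2025 Def. 14.1 for the site plane `{xᵢ = 0}`), the folded hitting weight `foldHitZAt` and
probability `foldHitProbAt`, and the registered sub-goal `foldHitProbAt_mem_Icc`. For `i = 0` these agree with `mirror`, `leftHalf`,
`foldHitZ`, `foldHitProb` definitionally (`foldHitProbAt_zero`).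
-/

noncomputable section

namespace Summit.CriticalPhenomena.Ising3DConformalLimit.Cruxes.ExistsScaleCovariantLimit.FoldedCurrentRepulsion

open Filter Finset
open scoped Topology BigOperators symmDiff ENNReal
open Literature.Probability.LatticeModels
open Classical

/-! ## Objects for the mirror `xᵢ ↦ −xᵢ` -/

/-- The site mirror `θᵢ : xᵢ ↦ −xᵢ` of `ℤ³` (mirror plane `{xᵢ = 0}` through sites), as a bijection of `ℤ³`. [folklore] -/
abbrev mirrorAt (i : Fin 3) : Site 3 ≃ Site 3 := (reflectCoord (d := 3) i).toEquiv

/-- Coordinates of the mirrored site. [folklore] -/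
theorem mirrorAt_apply (i : Fin 3) (x : Site 3) (j : Fin 3) : mirrorAt i x j = if j = i then -x j else x j :=
  reflectCoord_apply i x j

/-- The `i`-th coordinate of the mirrored site. [folklore] -/
@[simp] theorem mirrorAt_apply_same (i : Fin 3) (x : Site 3) : mirrorAt i x i = -x i := by
  rw [mirrorAt_apply, if_pos rfl]

/-- The other coordinates of the mirrored site. [folklore] -/
theorem mirrorAt_apply_ne (i : Fin 3) (x : Site 3) {j : Fin 3} (hj : j ≠ i) : mirrorAt i x j = x j := by
  rw [mirrorAt_apply, if_neg hj]

/-- The strict left half `Λ_L ∩ {xᵢ < 0}` of the box. [folklore] -/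
def leftHalfAt (i : Fin 3) (L : ℕ) : Finset (Site 3) := (box 3 L).filter fun x => x i < 0

/-- Membership in the strict left half. [folklore] -/
theorem mem_leftHalfAt {i : Fin 3} {L : ℕ} {x : Site 3} : x ∈ leftHalfAt i L ↔ x ∈ box 3 L ∧ x i < 0 := by
  rw [leftHalfAt, mem_filter]

/-- The mirror `θᵢ` preserves the centred box `Λ_L`. [folklore] -/
theorem mirrorAt_mem_box_iff (i : Fin 3) (L : ℕ) (x : Site 3) : mirrorAt i x ∈ box 3 L ↔ x ∈ box 3 L := by
  simp only [mem_box]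
  constructor
  · intro h j
    have := h j
    by_cases hj : j = i
    · subst hj; rw [mirrorAt_apply_same] at this; omega
    · rw [mirrorAt_apply_ne i x hj] at this; exact this
  · intro h j
    have := h j
    by_cases hj : j = i
    · subst hj; rw [mirrorAt_apply_same]; omega
    · rw [mirrorAt_apply_ne i x hj]; exact this

/-- **The Markovian reflection `θᵢ` of the box is a fold datum** (Duminil-Copin–Panis 2025 §2.2; Aizenman 2025 Def. 14.1): `θᵢ` is an
involutive automorphism of `ℤ³` preserving `Λ_L`, the strict left half is disjoint from its image, every non-fixed site lies in one of
them, and no bond joins them (the plane `{xᵢ = 0}` is a vertex cut). [folklore] -/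
theorem isFoldable_boxAt (i : Fin 3) (L : ℕ) : IsFoldable (zdGraph 3) (mirrorAt i) (box 3 L) (leftHalfAt i L) where
  invol := fun x => reflectCoord_reflectCoord i x
  adj_iff := fun x y => (reflectCoord (d := 3) i).map_adj_iff
  mem_iff := mirrorAt_mem_box_iff i L
  left_subset := filter_subset _ _
  left_disjoint := fun x hx hθx => by
    have h1 := (mem_leftHalfAt.1 hx).2
    have h2 := (mem_leftHalfAt.1 hθx).2
    rw [mirrorAt_apply_same] at h2
    omega
  cover := fun x hx hne => by
    have hx0 : x i ≠ 0 := by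
      intro h0
      apply hne
      funext j
      by_cases hj : j = i
      · subst hj; rw [mirrorAt_apply_same, h0, neg_zero]
      · exact mirrorAt_apply_ne i x hj
    rcases lt_or_gt_of_ne hx0 with hlt | hgt
    · exact Or.inl (mem_leftHalfAt.2 ⟨hx, hlt⟩)
    · refine Or.inr (mem_leftHalfAt.2 ⟨(mirrorAt_mem_box_iff i L x).2 hx, ?_⟩)
      rw [mirrorAt_apply_same]; omega
  no_cross := fun x hx y hxy hθy => by
    have h1 := (mem_leftHalfAt.1 hx).2
    have h2 := (mem_leftHalfAt.1 hθy).2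
    rw [mirrorAt_apply_same] at h2
    -- nearest neighbours differ by at most one in the `i`-th coordinate
    have h3 : y i ≤ x i + 1 := by
      obtain ⟨i', h | h⟩ := (zdGraph_adj_iff x y).1 hxy
      · rw [h, Pi.add_apply]
        by_cases hi : i = i'
        · subst hi; rw [Pi.single_eq_same]
        · rw [Pi.single_eq_of_ne hi]; omega
      · rw [h, Pi.add_apply]
        by_cases hi : i = i'
        · subst hi; rw [Pi.single_eq_same]; omega
        · rw [Pi.single_eq_of_ne hi]; omega
    omega

/-- **The folded hitting weight for the mirror `θᵢ`**: `Z^{xy}_{Λ_L,β}[y ⟷ {xᵢ = 0} in n + θᵢ(n)]`. [folklore] -/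
def foldHitZAt (i : Fin 3) (L : ℕ) (β : ℝ) (x y : Site 3) : ℝ≥0∞ :=
  ∑' n : edgesIn (zdGraph 3) (box 3 L) → ℕ,
    ind (csources (zdGraph 3) (box 3 L) n = {x} ∆ {y} ∧
        CSupp (zdGraph 3) (box 3 L) (edgesIn (zdGraph 3) (box 3 L)) n) *
      cweight (zdGraph 3) (box 3 L) β n * ind ((isFoldable_boxAt i L).ConnFix ((isFoldable_boxAt i L).fold n) y)

/-- **The folded hitting probability for the mirror `θᵢ`**: `P^{xy}_{Λ_L,β}[y ⟷ {xᵢ = 0} in n + θᵢ(n)]` (junk `0/0 = 0` never met for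
`β ≥ 0`). [folklore] -/
def foldHitProbAt (i : Fin 3) (L : ℕ) (β : ℝ) (x y : Site 3) : ℝ :=
  (foldHitZAt i L β x y).toReal /
    (currentZ (zdGraph 3) (box 3 L) β (edgesIn (zdGraph 3) (box 3 L)) ({x} ∆ {y})).toReal

/-! ## Elementary API -/

/-- For the zeroth coordinate the objects are the ones of `…FoldedCurrentDefs` (definitionally). [folklore] -/
theorem foldHitProbAt_zero (L : ℕ) (β : ℝ) (x y : Site 3) : foldHitProbAt 0 L β x y = foldHitProb L β x y := rfl

/-- The folded hitting weight is a partial sum of `Z({x} ∆ {y})`. [folklore] -/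
theorem foldHitZAt_le_currentZ (i : Fin 3) (L : ℕ) (β : ℝ) (x y : Site 3) :
    foldHitZAt i L β x y ≤ currentZ (zdGraph 3) (box 3 L) β (edgesIn (zdGraph 3) (box 3 L)) ({x} ∆ {y}) := by
  unfold foldHitZAt currentZ
  refine ENNReal.tsum_le_tsum fun n => ?_
  calc _ ≤ ind (csources (zdGraph 3) (box 3 L) n = {x} ∆ {y} ∧
          CSupp (zdGraph 3) (box 3 L) (edgesIn (zdGraph 3) (box 3 L)) n) * cweight (zdGraph 3) (box 3 L) β n * 1 := by
        gcongr; exact ind_le_one _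
    _ = _ := mul_one _

/-- `0 ≤ P ≤ 1` for the folded hitting probability of any coordinate mirror — registered sub-goal `foldHitProbAt_mem_Icc`. [folklore] -/
theorem foldHitProbAt_mem_Icc : ∀ (i : Fin 3) (L : ℕ) (β : ℝ) (x y : Site 3), foldHitProbAt i L β x y ∈ Set.Icc (0 : ℝ) 1 := by
  intro i L β x y
  refine ⟨div_nonneg ENNReal.toReal_nonneg ENNReal.toReal_nonneg, ?_⟩
  unfold foldHitProbAt
  by_cases htop : currentZ (zdGraph 3) (box 3 L) β (edgesIn (zdGraph 3) (box 3 L)) ({x} ∆ {y}) = ∞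
  · rw [htop, ENNReal.toReal_top, div_zero]; exact zero_le_one
  refine div_le_one_of_le₀ ?_ ENNReal.toReal_nonneg
  exact ENNReal.toReal_mono htop (foldHitZAt_le_currentZ i L β x y)

end Summit.CriticalPhenomena.Ising3DConformalLimit.Cruxes.ExistsScaleCovariantLimit.FoldedCurrentRepulsion

end
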